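import Summits.AtomisticToContinuum.Crystallization.Theorems.HullExactificationCascadeRobustBarlowTemplateTransportDefs
import Mathlib.Analysis.InnerProductSpace.PiL2
import Mathlib.Analysis.Convex.Basic
import Mathlib.Topology.MetricSpace.Basic
import Mathlib.Analysis.Normed.Module.Basic
import Mathlib.Topology.Order.IntermediateValue
import Mathlib.Topology.Order.OrderClosed
import Mathlib.Order.Filter.Finite

/-!
# `injective_cellwiseApprox` for line `registered` (crux `RobustBarlowTemplate`, stmt-AtomisticToContinuum-12088)

Globalisation of a cellwise approximate-linearity estimate.

**Statement.** Let `K ⊆ ℝ³` be convex and covered by a finite family `𝒞` of closed convex sets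
("cells"), let `f` be continuous on `K`, `L` a continuous linear map and `κ` a constant such that
on each cell `C ∈ 𝒞` the map `f` is `κ`-approximately `L` on `C ∩ K`, i.e.
`‖f y - f y' - L (y - y')‖ ≤ κ * ‖y - y'‖` for `y, y' ∈ C ∩ K`.  Then the same estimate holds for
all `y, y' ∈ K` (this is the hypothesis shape of Mathlib's `ApproximatesLinearOn`).

**Proof outline** (continuous induction along the segment).  Fix `y, y' ∈ K` and parametrise the
segment by `γ t = y' + t • (y - y')`, `t ∈ [0, 1]`; it stays in `K` by convexity.  Consider the set
`s` of `t ∈ [0, 1]` with `‖f (γ t) - f y' - L (γ t - y')‖ ≤ κ * (t * ‖y - y'‖)`.  It is closed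
(continuity of `f` on `K`), contains `0`, and is a right-neighbourhood of each of its points
`t < 1`: the finitely many closed cells not containing `γ t` are avoided by `γ t'` for `t'` near
`t`, so any cell containing `γ t'` (the cells cover `K`) also contains `γ t`, and the cell
estimate between `γ t` and `γ t'` adds up with the inductive bound by the triangle inequality
(`γ t' - γ t = (t' - t) • (y - y')`).  Mathlib's continuous induction principle
`IsClosed.Icc_subset_of_forall_mem_nhdsWithin` then gives `1 ∈ s`, which is the claim.

**Contents.** The single theorem `injective_cellwiseApprox` (no helpers).
-/

noncomputable section

namespace Summit.AtomisticToContinuum.Crystallization.Theorems.HullExactificationCascadeRobustBarlowTemplate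

open RealInnerProductSpace Set Filter Topology

/-- Euclidean `3`-space. -/
local notation "E3" => EuclideanSpace ℝ (Fin 3)

/-- SUB-GOAL `injective_cellwiseApprox` (registered; toward `develop_injective`, piece I6): on a convex set
covered by finitely many closed convex cells, a continuous map that is `κ`-approximately `L` on
each cell is `κ`-approximately `L` on the whole set. -/
theorem injective_cellwiseApprox :
    ∀ (f : E3 → E3) (L : E3 →L[ℝ] E3) (κ : ℝ) (K : Set E3) (𝒞 : Set (Set E3)), 0 ≤ κ → Convex ℝ K →
      𝒞.Finite → (∀ C ∈ 𝒞, Convex ℝ C ∧ IsClosed C) → K ⊆ ⋃₀ 𝒞 → ContinuousOn f K →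
      (∀ C ∈ 𝒞, ∀ y ∈ C ∩ K, ∀ y' ∈ C ∩ K, ‖f y - f y' - L (y - y')‖ ≤ κ * ‖y - y'‖) →
      ∀ y ∈ K, ∀ y' ∈ K, ‖f y - f y' - L (y - y')‖ ≤ κ * ‖y - y'‖ := by
  intro f L κ K 𝒞 _hκ hK h𝒞 hcell hcov hf hest y hy y' hy'
  -- the segment from `y'` (time `0`) to `y` (time `1`)
  set γ : ℝ → E3 := fun t => y' + t • (y - y') with hγ
  have hγc : Continuous γ := by
    simp only [hγ]
    fun_prop
  have hγ0 : γ 0 = y' := by simp [hγ]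
  have hγ1 : γ 1 = y := by simp [hγ]
  have hγK : ∀ t ∈ Icc (0 : ℝ) 1, γ t ∈ K := fun t ht => hK.add_smul_sub_mem hy' hy ht
  have hγsub : ∀ t t' : ℝ, γ t - γ t' = (t - t') • (y - y') := by
    intro t t'
    simp only [hγ]
    rw [sub_smul]
    abel
  -- `f ∘ γ` is continuous on `[0, 1]`
  have hfγ : ContinuousOn (fun t => f (γ t)) (Icc (0 : ℝ) 1) :=
    hf.comp hγc.continuousOn fun t ht => hγK t ht
  -- the inductive set
  set s : Set ℝ :=
    {t ∈ Icc (0 : ℝ) 1 | ‖f (γ t) - f y' - L (γ t - y')‖ ≤ κ * (t * ‖y - y'‖)} with hs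
  have hclosed : IsClosed s := by
    refine isClosed_Icc.isClosed_le ?_ (by fun_prop)
    exact ((hfγ.sub continuousOn_const).sub
      (L.continuous.comp (hγc.sub continuous_const)).continuousOn).norm
  have h0 : (0 : ℝ) ∈ s := by
    refine ⟨left_mem_Icc.2 zero_le_one, ?_⟩
    simp [hγ0]
  have key : Icc (0 : ℝ) 1 ⊆ s := by
    refine (hclosed.inter isClosed_Icc).Icc_subset_of_forall_mem_nhdsWithin h0 ?_
    rintro t ⟨⟨htI, hts⟩, ht0, ht1⟩
    -- near `t`, the curve avoids every (closed) cell not containing `γ t`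
    have hN : (⋂ C ∈ 𝒞, {t' : ℝ | γ t' ∈ C → γ t ∈ C}) ∈ 𝓝 t := by
      refine (biInter_mem h𝒞).2 fun C hC => ?_
      by_cases htC : γ t ∈ C
      · exact univ_mem' fun t' _ => htC
      · have hopen : IsOpen (γ ⁻¹' Cᶜ) := (hcell C hC).2.isOpen_compl.preimage hγc
        filter_upwards [hopen.mem_nhds htC] with t' ht' h using absurd h ht'
    filter_upwards [mem_nhdsWithin_of_mem_nhds hN, Ioo_mem_nhdsGT ht1] with t' ht' htt'
    obtain ⟨htt', ht'1⟩ := htt'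
    have ht'I : t' ∈ Icc (0 : ℝ) 1 := ⟨ht0.trans htt'.le, ht'1.le⟩
    have hγt'K : γ t' ∈ K := hγK t' ht'I
    obtain ⟨C, hC, hγt'C⟩ := mem_sUnion.1 (hcov hγt'K)
    simp only [mem_iInter, mem_setOf_eq] at ht'
    have hγtC : γ t ∈ C := ht' C hC hγt'C
    -- the cell estimate between `γ t'` and `γ t`
    have h1 := hest C hC (γ t') ⟨hγt'C, hγt'K⟩ (γ t) ⟨hγtC, hγK t htI⟩
    have hn : ‖γ t' - γ t‖ = (t' - t) * ‖y - y'‖ := by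
      rw [hγsub, norm_smul, Real.norm_eq_abs, abs_of_pos (sub_pos.2 htt')]
    rw [hn] at h1
    refine ⟨ht'I, ?_⟩
    have hsplit : f (γ t') - f y' - L (γ t' - y') =
        (f (γ t') - f (γ t) - L (γ t' - γ t)) + (f (γ t) - f y' - L (γ t - y')) := by
      rw [map_sub, map_sub, map_sub]
      abel
    calc ‖f (γ t') - f y' - L (γ t' - y')‖
        = ‖(f (γ t') - f (γ t) - L (γ t' - γ t)) + (f (γ t) - f y' - L (γ t - y'))‖ := by
          rw [hsplit]
      _ ≤ ‖f (γ t') - f (γ t) - L (γ t' - γ t)‖ + ‖f (γ t) - f y' - L (γ t - y')‖ :=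
          norm_add_le _ _
      _ ≤ κ * ((t' - t) * ‖y - y'‖) + κ * (t * ‖y - y'‖) := add_le_add h1 hts
      _ = κ * (t' * ‖y - y'‖) := by ring
  have h1 := key (right_mem_Icc.2 zero_le_one)
  simp only [hs, mem_setOf_eq, hγ1, one_mul] at h1
  exact h1.2

end Summit.AtomisticToContinuum.Crystallization.Theorems.HullExactificationCascadeRobustBarlowTemplate

end
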